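import Summits.QuantumAdvantage.AdviceFreeQNC0.NPGamma37FourierFamily
import HarnessLib

/-!
# Cell qa-qnc0 — rung (NP-Σ) `RingHardSymFourier3`: outputs = ARBITRARY functions of the HAMMING WEIGHT `|x|` and of `≤ log₂ n` insulated-sparse / linear polynomials ("balanced-window freezing").

Planner qa-qnc0-p2 gen 34 (INBOX P2-34h, memo HOME/qa-qnc0-p2/ROUND-34P2.md §4.9).  Imports the (NP-ΓΛ) files
`NPGamma37Fourier{,Family,Loss}` (the Fourier class `PQ Q f`, its slice expansion and character family `rowsQ`/`coefsQ`,
`card_loss_sliceQ`, `mass_rows_leQ`, the numerics `numericsΛ`).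

THEOREM (NP-Σ) `ringHardSymFourier3_explicit`: for `n ≥ 200`, a support family `𝓢` with `8·log₂ n` insulated windows, `R ≤ log₂ n`,
ANY `Q g i ∈ span {mono S : S ∈ 𝓢}` and ANY tables `f : Fin n → ℕ → (Fin R → ZMod 3) → Bool`, the strategy
`x ↦ (f g |x| (Q g 1 x, …, Q g R x))_g` wins the `p = 3` ring-HLF relation on at most `(1 − n^{−15})·2^{n−1}` odd inputs;
dense special case (NP-ΣΛ) `ringHardSymLinForms3_explicit` (`|x|` and `≤ log₂ n` arbitrary linear forms over `𝔽₃`).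
In particular every strategy whose outputs are SYMMETRIC functions of the input composed with `log n` linear forms —
e.g. the elementary symmetric polynomials `e₃ = C(|x|,3) mod 3` (a function of `|x| mod 9`, of linear-form complexity `≥ n/3`,
outside (NP-Λ)) — obeys a `1 − n^{−15}` law.

THE ONE NEW STEP — BALANCED-WINDOW FREEZING.  The pair move of window `j` flips the two data bits `x_{p_j}, x_{p_j+1}`; on a
base point `a` whose window pattern is BALANCED (`x_{p_j}(a) ≠ x_{p_j+1}(a)`) the move swaps the two bits, so `|x|` is
CONSTANT on the slice of a base point balanced at all `F` windows (`wtX_U`, via the window transposition `swpPerm`), and there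
the strategy coincides with the Fourier-class strategy `PQ Q (f · |x(a)|)` already handled by (NP-ΓΛ).  Balanced base points
have density exactly `2^{−F}` (`card_balAll`, an involution count), and — the point — the resonance MGF SURVIVES THE
RESTRICTION: the insulator involutions `φ₁, φ₂` of `Resonance37G` each toggle balancedness of their window while
`φ₁ ∘ φ₂` maps the balanced pattern `(b, ¬b)` to its ANTIPODE `(¬b, b)`, and antipodal patterns have opposite slopes, so
with `κ ≠ 0` at most ONE of them resonates (`antipodal`, `decide`); the Klein-four orbit bound for the balanced-weighted
factors (`bal_orbit_leN`) feeds the abstract `orbit_mgf` and gives `Σ_{a balanced} 2^{Z(a)} ≤ 2ⁿ(3/4)^F = #balanced·(3/2)^F`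
(`resonance_windows_bal`, `resonance_poly_bal`).  The (NP-ΓΛ) assembly then runs over balanced base points only
(`symLoss`), losing the density factor `2^F = n^8` in the exponent: `e = 7 + 8 = 15`.

SCOPE (honest): a RUNG (`1 − n^{−15}` law), not the uniform-`θ` crux `RingDenseResidualLt3` (stmt-QuantumAdvantage-22907);
the residual after (NP-Σ) is: outputs of high `𝔽₃`-Fourier dimension over {insulated-sparse polys, linear forms} that are NOT
functions of `|x|` — e.g. generic dense quadratic forms, or `e₃` of a half of the variables.
-/

noncomputable section

namespace Summit.QuantumAdvantage.AdviceFreeQNC0.NPGamma37Proof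

open Finset F4
open Classical
open Summit.QuantumAdvantage.AdviceFreeQNC0.AffBells37 (exists_ne_one_of_mass_lt ev L sparse_ne_one two_pow_L_le)
open Summit.QuantumAdvantage.AdviceFreeQNC0.Resonance37G (orbit_mgf blockCpl blockCpl_involutive uExt_blockCpl xN xN_eq_xOfU
  xN_blockCpl_of_ne xN_blockCpl_left xN_blockCpl_right Inv letter)

variable {F : ℕ}

section Sym

open Literature.Computability.QuantumComplexity Literature.Computability.QuantumComplexity.RingHLF
open Literature.Computability.MetaComplexity
open AffBells23 AffBells26
open Summit.QuantumAdvantage.AdviceFreeQNC0.NPGamma37 (InsulatedWindows)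

variable {n : ℕ}
variable {N : ℕ}
variable {R : ℕ}

/-! ### Statements -/

/-- the Hamming weight `|x|` of an input. -/
def wtX (x : Fin N → Bool) : ℕ := (univ.filter fun i : Fin N => x i = true).card

/-- **(NP-Σ) symmetric-plus-Fourier-sparse hardness at `p = 3`**: outputs `f_g(|x|, Q_{g,1}(x), …, Q_{g,R}(x))` with ARBITRARY
tables `f_g : ℕ → 𝔽₃^R → Bool`, `R ≤ log₂ N` and the `Q_{g,i}` in the span of an insulated-sparse support family. -/
def RingHardSymFourier3 : Prop :=
  ∃ e C n₀ : ℕ, ∀ N ≥ n₀, ∀ 𝓢 : Set (Finset (Fin N)), InsulatedWindows 𝓢 (C * Nat.log 2 N) →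
    ∀ R ≤ Nat.log 2 N, ∀ Q : Fin N → Fin R → Smolensky.CubeFn (ZMod 3) N,
      (∀ g i, Q g i ∈ Submodule.span (ZMod 3) (Smolensky.mono (ZMod 3) '' 𝓢)) →
      ∀ f : Fin N → ℕ → (Fin R → ZMod 3) → Bool,
        ((univ.filter fun x : Fin N → Bool =>
            OddZeros x ∧ RingHLF.Rel x (fun g => f g (wtX x) (fun i => Q g i x))).card : ℝ)
          ≤ (1 - 1 / (N : ℝ) ^ e) * (2 : ℝ) ^ (N - 1)

/-- **(NP-ΣΛ)** the dense special case: outputs `f_g(|x|, L_{g,1}(x), …, L_{g,R}(x))`, `R ≤ log₂ N` arbitrary LINEAR FORMS. -/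
def RingHardSymLinForms3 : Prop :=
  ∃ e n₀ : ℕ, ∀ N ≥ n₀, ∀ R ≤ Nat.log 2 N, ∀ Lf : Fin N → Fin R → Fin N → ZMod 3,
    ∀ f : Fin N → ℕ → (Fin R → ZMod 3) → Bool,
      ((univ.filter fun x : Fin N → Bool =>
          OddZeros x ∧ RingHLF.Rel x
            (fun g => f g (wtX x) (fun i => ∑ m : Fin N, if x m then Lf g i m else 0))).card : ℝ)
        ≤ (1 - 1 / (N : ℝ) ^ e) * (2 : ℝ) ^ (N - 1)

/-! ### 1. Antipodal patterns and the balanced resonance MGF -/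

set_option synthInstance.maxHeartbeats 400000 in
set_option synthInstance.maxSize 4096 in
/-- antipodal patterns `(b,b')`, `(¬b,¬b')` have opposite slopes, so with `κ ≠ 0` at most one of them resonates. -/
theorem antipodal : ∀ (cA cB cAB m κ : ZMod 3) (xA xB : Bool), κ ≠ 0 →
    ¬ (m * Resonance37G.slope cA cB cAB xA xB + κ = 0 ∧
        m * Resonance37G.slope cA cB cAB (!xA) (!xB) + κ = 0) := by
  decide

/-- balanced resonance weight of one window: `0` if the pattern is unbalanced, `4` if balanced and resonant, else `2`. -/
def gBN (cA cB cAB m κ : ZMod 3) (b b' : Bool) : ℕ :=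
  if b = b' then 0 else if m * Resonance37G.slope cA cB cAB b b' + κ = 0 then 4 else 2

set_option synthInstance.maxHeartbeats 400000 in
set_option synthInstance.maxSize 4096 in
/-- Klein-four orbit bound for the balanced weights: exactly two patterns of an orbit are balanced, they are antipodal,
and at most one of them resonates: `4 + 2 ≤ 6`. -/
theorem bal_orbit_leN : ∀ (cA cB cAB m κ : ZMod 3) (b b' : Bool), κ ≠ 0 →
    gBN cA cB cAB m κ b b' + gBN cA cB cAB m κ (!b) b' + gBN cA cB cAB m κ b (!b') +
      gBN cA cB cAB m κ (!b) (!b') ≤ 6 := by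
  decide

/-- all `F` windows balanced at the base point `a`: `x_{p_j}(a) ≠ x_{p_j+1}(a)`. -/
def BalAll (p : ℕ → ℕ) (F : ℕ) (a : Fin n → Bool) : Prop := ∀ j : Fin F, xN a (p j) ≠ xN a (p j + 1)

/-- **(R′-bal) THE RESONANCE MGF RESTRICTED TO BALANCED BASE POINTS**: `Σ_{a balanced} 2^{#resonant} ≤ 2ⁿ(3/4)^F`. -/
theorem resonance_windows_bal (F : ℕ) (p q : ℕ → ℕ)
    (hord : ∀ j < F, q j < p j ∧ p j + 1 < q (j + 1)) (hqF : q F < n)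
    (m : ZMod 3) (cA cB cAB κ : Fin F → (Fin n → Bool) → ZMod 3)
    (hA : ∀ j, Inv F p q (cA j)) (hB : ∀ j, Inv F p q (cB j)) (hAB : ∀ j, Inv F p q (cAB j))
    (hκ : ∀ j, Inv F p q (κ j)) (hκ0 : ∀ j a, κ j a ≠ 0) :
    (∑ a : Fin n → Bool, if BalAll p F a then (2 : ℝ) ^ (univ.filter fun j : Fin F =>
        letter m (cA j) (cB j) (cAB j) (κ j) (p j) a = 0).card else 0)
      ≤ (2 : ℝ) ^ n * (3 / 4 : ℝ) ^ F := by
  -- monotonicity of the insulators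
  have hqmono : ∀ i j : ℕ, i ≤ j → j ≤ F → q i ≤ q j := by
    intro i j hij hjF
    induction j with
    | zero =>
      have : i = 0 := by omega
      subst this; exact le_rfl
    | succ j ih =>
      by_cases hij' : i = j + 1
      · subst hij'; exact le_rfl
      · have h1 := ih (by omega) (by omega)
        have h2 := hord j (by omega)
        omega
  have hpos : ∀ j : Fin F, q j < p j ∧ p j + 1 < q (j + 1) ∧ q (j + 1) ≤ q F := fun j =>
    ⟨(hord j j.2).1, (hord j j.2).2, hqmono (j + 1) F (by have := j.2; omega) le_rfl⟩
  have hsep : ∀ j j' : Fin F, j.val < j'.val → p j + 1 < q (j + 1) ∧ q (j + 1) ≤ q j' ∧ q j' < p j' :=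
    fun j j' hjj => ⟨(hord j j.2).2, hqmono (j + 1) j' (by omega) (by have := j'.2; omega), (hord j' j'.2).1⟩
  -- the balanced-weighted factors and the involutions
  set g : Fin F → (Fin n → Bool) → ℝ := fun j a =>
    (gBN (cA j a) (cB j a) (cAB j a) m (κ j a) (xN a (p j)) (xN a (p j + 1)) : ℝ) with hg
  set φ₁ : Fin F → (Fin n → Bool) → (Fin n → Bool) := fun j => blockCpl (q j) (p j - 1) with hφ₁
  set φ₂ : Fin F → (Fin n → Bool) → (Fin n → Bool) := fun j => blockCpl (p j + 1) (q (j + 1) - 1) with hφ₂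
  have hprod : ∀ a : Fin n → Bool,
      (if BalAll p F a then (2 : ℝ) ^ F * (2 : ℝ) ^ (univ.filter fun j : Fin F =>
          letter m (cA j) (cB j) (cAB j) (κ j) (p j) a = 0).card else 0)
        = ∏ j ∈ (univ : Finset (Fin F)), g j a := by
    intro a
    split_ifs with hb
    · have hgj : ∀ j : Fin F, g j a = 2 * (if letter m (cA j) (cB j) (cAB j) (κ j) (p j) a = 0 then 2 else 1) := by
        intro j
        simp only [hg]
        rw [gBN, if_neg (hb j)]
        unfold letter
        split_ifs <;> norm_num
      rw [prod_congr rfl fun j _ => hgj j, prod_mul_distrib, prod_const, card_univ, Fintype.card_fin,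
        prod_ite, prod_const, prod_const_one, mul_one]
    · unfold BalAll at hb
      push Not at hb
      obtain ⟨j, hj⟩ := hb
      symm
      refine prod_eq_zero (mem_univ j) ?_
      simp only [hg]
      rw [gBN, if_pos hj]
      simp
  have hmain := orbit_mgf (univ : Finset (Fin F)) g φ₁ φ₂
    (fun j => blockCpl_involutive _ _) (fun j => blockCpl_involutive _ _) ?_ ?_
    (fun j a => by simp only [hg]; exact Nat.cast_nonneg _) ?_
  · have hF : (∑ a : Fin n → Bool, if BalAll p F a then (2 : ℝ) ^ F * (2 : ℝ) ^ (univ.filter fun j : Fin F =>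
        letter m (cA j) (cB j) (cAB j) (κ j) (p j) a = 0).card else 0) ≤ (2 : ℝ) ^ n * (3 / 2 : ℝ) ^ F := by
      simp_rw [hprod]
      simpa [card_univ, Fintype.card_fin, Fintype.card_bool, Fintype.card_fun] using hmain
    have hpull : (2 : ℝ) ^ F * (∑ a : Fin n → Bool, if BalAll p F a then (2 : ℝ) ^ (univ.filter fun j : Fin F =>
        letter m (cA j) (cB j) (cAB j) (κ j) (p j) a = 0).card else 0)
        = ∑ a : Fin n → Bool, if BalAll p F a then (2 : ℝ) ^ F * (2 : ℝ) ^ (univ.filter fun j : Fin F =>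
          letter m (cA j) (cB j) (cAB j) (κ j) (p j) a = 0).card else 0 := by
      rw [mul_sum]
      exact sum_congr rfl fun a _ => by split_ifs <;> simp
    have h2F : (0 : ℝ) < (2 : ℝ) ^ F := by positivity
    have h34 : (2 : ℝ) ^ n * (3 / 2 : ℝ) ^ F = ((2 : ℝ) ^ n * (3 / 4 : ℝ) ^ F) * (2 : ℝ) ^ F := by
      rw [mul_assoc, ← mul_pow]; norm_num
    rw [← hpull, h34, mul_comm] at hF
    exact le_of_mul_le_mul_right hF h2F
  · -- φ₁ j fixes the factor of j' ≠ j
    intro j j' hjj a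
    simp only [hg, hφ₁]
    rw [((hA j') j j.2 a).1, ((hB j') j j.2 a).1, ((hAB j') j j.2 a).1, ((hκ j') j j.2 a).1]
    have hq := hpos j
    have hq' := hpos j'
    rcases lt_or_gt_of_ne (fun h : j.val = j'.val => hjj (Fin.ext h)) with hlt | hgt
    · have hs := hsep j j' hlt
      rw [xN_blockCpl_of_ne _ _ (by omega) (by omega) a (p j') (by omega) (by omega),
        xN_blockCpl_of_ne _ _ (by omega) (by omega) a (p j' + 1) (by omega) (by omega)]
    · have hs := hsep j' j hgt
      rw [xN_blockCpl_of_ne _ _ (by omega) (by omega) a (p j') (by omega) (by omega),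
        xN_blockCpl_of_ne _ _ (by omega) (by omega) a (p j' + 1) (by omega) (by omega)]
  · -- φ₂ j fixes the factor of j' ≠ j
    intro j j' hjj a
    simp only [hg, hφ₂]
    rw [((hA j') j j.2 a).2, ((hB j') j j.2 a).2, ((hAB j') j j.2 a).2, ((hκ j') j j.2 a).2]
    have hq := hpos j
    have hq' := hpos j'
    rcases lt_or_gt_of_ne (fun h : j.val = j'.val => hjj (Fin.ext h)) with hlt | hgt
    · have hs := hsep j j' hlt
      rw [xN_blockCpl_of_ne _ _ (by omega) (by omega) a (p j') (by omega) (by omega),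
        xN_blockCpl_of_ne _ _ (by omega) (by omega) a (p j' + 1) (by omega) (by omega)]
    · have hs := hsep j' j hgt
      rw [xN_blockCpl_of_ne _ _ (by omega) (by omega) a (p j') (by omega) (by omega),
        xN_blockCpl_of_ne _ _ (by omega) (by omega) a (p j' + 1) (by omega) (by omega)]
  · -- the Klein-four orbit bound, balanced version
    intro j a
    simp only [hg, hφ₁, hφ₂]
    have hq := hpos j
    -- coefficients are invariant
    have cA1 := ((hA j) j j.2 a).1; have cB1 := ((hB j) j j.2 a).1
    have cAB1 := ((hAB j) j j.2 a).1; have κ1 := ((hκ j) j j.2 a).1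
    have cA2 := ((hA j) j j.2 a).2; have cB2 := ((hB j) j j.2 a).2
    have cAB2 := ((hAB j) j j.2 a).2; have κ2 := ((hκ j) j j.2 a).2
    set a₂ := blockCpl (p j + 1) (q (j + 1) - 1) a with ha₂
    have cA12 : cA j (blockCpl (q j) (p j - 1) a₂) = cA j a := by rw [((hA j) j j.2 a₂).1, cA2]
    have cB12 : cB j (blockCpl (q j) (p j - 1) a₂) = cB j a := by rw [((hB j) j j.2 a₂).1, cB2]
    have cAB12 : cAB j (blockCpl (q j) (p j - 1) a₂) = cAB j a := by rw [((hAB j) j j.2 a₂).1, cAB2]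
    have κ12 : κ j (blockCpl (q j) (p j - 1) a₂) = κ j a := by rw [((hκ j) j j.2 a₂).1, κ2]
    -- the pattern bits on the orbit
    have x1A : xN (blockCpl (q j) (p j - 1) a) (p j) = !xN a (p j) := by
      have := xN_blockCpl_right (q j) (p j - 1) (by omega) (by omega) a
      rwa [show p j - 1 + 1 = p j by omega] at this
    have x1B : xN (blockCpl (q j) (p j - 1) a) (p j + 1) = xN a (p j + 1) :=
      xN_blockCpl_of_ne _ _ (by omega) (by omega) a _ (by omega) (by omega)
    have x2A : xN a₂ (p j) = xN a (p j) := xN_blockCpl_of_ne _ _ (by omega) (by omega) a _ (by omega) (by omega)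
    have x2B : xN a₂ (p j + 1) = !xN a (p j + 1) := xN_blockCpl_left _ _ (by omega) (by omega) a
    have x12A : xN (blockCpl (q j) (p j - 1) a₂) (p j) = !xN a (p j) := by
      have := xN_blockCpl_right (q j) (p j - 1) (by omega) (by omega) a₂
      rw [show p j - 1 + 1 = p j by omega] at this
      rw [this, x2A]
    have x12B : xN (blockCpl (q j) (p j - 1) a₂) (p j + 1) = !xN a (p j + 1) := by
      rw [xN_blockCpl_of_ne _ _ (by omega) (by omega) a₂ _ (by omega) (by omega), x2B]
    rw [cA1, cB1, cAB1, κ1, cA2, cB2, cAB2, κ2, cA12, cB12, cAB12, κ12, x1A, x1B, x2A, x2B, x12A, x12B]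
    exact_mod_cast bal_orbit_leN (cA j a) (cB j a) (cAB j a) m (κ j a) (xN a (p j)) (xN a (p j + 1)) (hκ0 j a)

/-- (R′-bal) for the Fourier test rows: `Σ_{a balanced} 2^{Zcount} ≤ 2ⁿ(3/4)^F`. -/
theorem resonance_poly_bal {p q : ℕ → ℕ} (hord : ∀ j < F, q j < p j ∧ p j + 1 < q (j + 1)) (hqF : q F < n)
    (P : Fin (n + 1) → Smolensky.CubeFn (ZMod 3) (n + 1)) (hIA : ∀ g, IA p q F (P g))
    (g : Fin (n + 1)) (σ m : ZMod 3) (hσ : σ ≠ 0) :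
    (∑ a : Fin n → Bool, if BalAll p F a then (2 : ℝ) ^ Zcount (F := F) P p a g σ m else 0)
      ≤ (2 : ℝ) ^ n * (3 / 4 : ℝ) ^ F := by
  have hS := sep_of_ord hord hqF
  have h := resonance_windows_bal F p q hord hqF m
    (fun j a => cA (P g) (p j) (p j + 1) (xOfU a)) (fun j a => cB (P g) (p j) (p j + 1) (xOfU a))
    (fun j a => cAB (P g) (p j) (p j + 1) (xOfU a)) (fun j a => pathRow p a g σ j)
    (fun j => inv_of_flip hord hqF j _ fun x c hc => (cA_adm (P g) (hIA g) j x c hc).1)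
    (fun j => inv_of_flip hord hqF j _ fun x c hc => (cA_adm (P g) (hIA g) j x c hc).2.1)
    (fun j => inv_of_flip hord hqF j _ fun x c hc => (cA_adm (P g) (hIA g) j x c hc).2.2)
    ?_ (fun j a => pathRow_ne_zero p a g hσ j)
  · refine le_of_eq_of_le ?_ h
    refine Fintype.sum_congr _ _ fun a => ?_
    split_ifs
    · unfold Zcount
      congr 2
      exact filter_congr fun j _ => by rw [testRow_eq_letter hS]
    · rfl
  · -- the path letter only reads `u_{p j}`, which no insulator block contains
    intro j j' hj' a
    have h1 := hord j' hj'
    have h2 := q_mono hord (j' + 1) F (by omega) le_rfl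
    have hpj := hord j.val j.isLt
    unfold pathRow
    constructor
    · simp only
      rw [uExt_blockCpl, if_neg]
      by_cases hjj : j.val = j'
      · subst hjj; omega
      · rcases p_window hord j.val j' j.isLt hj' hjj with h | h <;> omega
    · simp only
      rw [uExt_blockCpl, if_neg]
      by_cases hjj : j.val = j'
      · subst hjj; omega
      · rcases p_window hord j.val j' j.isLt hj' hjj with h | h <;> omega

end Sym

end Summit.QuantumAdvantage.AdviceFreeQNC0.NPGamma37Proof
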